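import Literature.AlgebraicGeometry.Resolution.PointBlowupMohWitnessPrimePower
import Literature.RingTheory.MvPolynomial.MonomialCompleteIntersection
import HarnessLib

/-!
# Fedder's element of a purely inseparable germ `x₀^q + F(x₁, …, x_m)` with `ord F ≥ q` and `m < q` lies in `𝔪^[p]`

Support file (OURS; kill test K4.5(iii), cell `res-hironaka`, slot W4.5, door FrobeniusLadder) for
the rank-4 rung `FRationalResolution` (stmt-ResolutionOfSingularities-15317) of route
`FrobeniusLadder`: the why-easier of that rung bets that the residual-order ("shade") increase
under point blow-ups needs F-IMPURITY (route header, Cheapest falsifier (ii)).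

Fedder's criterion ([Fedder1983] Thm. 1.12; recorded e.g. as Thm. 2.3 of arXiv:2305.15487): for
`S` a polynomial (or regular local, F-finite) ring of characteristic `p` and `f ∈ S`, the
hypersurface `S/(f)` is F-pure at the origin iff `f^{p-1} ∉ 𝔪^[p] = (x₀^p, …, x_m^p)`.

**The box lemma** (`fedderElement_mem_span_X_pow`). Let `k` be any commutative ring, `p ≥ 2`,
`p ≤ q`, and `F ∈ k[x₀, …, x_m]` a polynomial not involving `x₀` all of whose monomials have
total degree `≥ q`. If `m < q` then `(x₀^q + F)^{p-1} ∈ (x₀^p, …, x_m^p)`.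

Proof. Every monomial of `x₀^q + F` has total degree `≥ q` and `x₀`-exponent `0` or `≥ q`;
these two properties propagate through products (`forall_support_pow` of
`PointBlowupMohWitnessPrimePower`), so a monomial `x^d` of the `(p-1)`-st power has degree
`≥ (p-1)q` and `d₀ = 0 ∨ d₀ ≥ q ≥ p`. In the second case `x^d ∈ (x₀^p)`. In the first case, if
all exponents were `≤ p-1`, the degree would be `≤ m(p-1) < q(p-1)` (only the `m` variables
`x₁..x_m` occur) — a contradiction; so some exponent is `≥ p`. Membership in the monomial ideal
is then `mem_span_X_pow_iff` (`MonomialCompleteIntersection`).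

Consequence used by the kill test (no Lean content beyond the lemma; Fedder's criterion is the
cited bridge): the cleaned local equation `x₀^q + F` of the kangaroo atlas (`q = pᵉ` the order,
`F` the residual polynomial in the `m = dim − 1` other variables, `ord F ≥ q`) is NEVER F-pure
when `m < q` — i.e. for every dimension-3 atlas row with `q ≥ 3` (246 of the 311 gen-1/gen-2
increase edges and all 36 `kmax = 2` edges) and every `q ∈ {4, 9}` row; F-purity (a fortiori
F-regularity) of an antelope germ is possible only for `(p, q, dim) ∈ {(2,2,3), (2,2,4), (3,3,4)}`,
where the kill test decides it by computation (job j258667).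

References: [Fedder1983] R. Fedder, F-purity and rational singularity, Trans. AMS 278 (1983)
461–480, Thm. 1.12. AI review is weaker than expert review; this file is an OURS instrument and
makes no statement about any manuscript.
-/

-- single-problem summit: the doubled namespace component `ResolutionOfSingularities` is forced
set_option linter.dupNamespace false

namespace Summit.ResolutionOfSingularities.ResolutionOfSingularities.Theorems.FRationalResolution.FedderBox

open MvPolynomial
open Literature.AlgebraicGeometry.Resolution.PointBlowup (forall_support_pow forall_support_add
  forall_support_X_pow)
open Literature.RingTheory.MvPolynomial (mem_span_X_pow_iff)

variable {k : Type} [CommRing k] {m : ℕ}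

omit [CommRing k] in
/-- The graded support predicate "after `n` factors the monomial `d` has total degree `≥ n·q` and
`x₀`-exponent `0` or `≥ q`" is additive in `(n, d)`. [folklore] -/
theorem boxPred_add (q n₁ n₂ : ℕ) (a c : Fin (m + 1) →₀ ℕ)
    (ha : n₁ * q ≤ a.degree ∧ (a 0 = 0 ∨ q ≤ a 0)) (hc : n₂ * q ≤ c.degree ∧ (c 0 = 0 ∨ q ≤ c 0)) :
    (n₁ + n₂) * q ≤ (a + c).degree ∧ ((a + c) 0 = 0 ∨ q ≤ (a + c) 0) := by
  refine ⟨?_, ?_⟩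
  · rw [map_add, add_mul]
    exact Nat.add_le_add ha.1 hc.1
  · rw [Finsupp.add_apply]
    rcases ha.2 with h | h <;> rcases hc.2 with h' | h'
    · exact Or.inl (by rw [h, h', add_zero])
    · exact Or.inr (by rw [h, zero_add]; exact h')
    · exact Or.inr (by rw [h', add_zero]; exact h)
    · exact Or.inr (le_add_right h)

/-- Every monomial `d` of `x₀^q + F` has degree `≥ 1·q` and `x₀`-exponent `0` or `≥ q`, when `F`
does not involve `x₀` and has order `≥ q`. [folklore] -/
theorem boxPred_base (q : ℕ) (F : MvPolynomial (Fin (m + 1)) k)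
    (hF0 : ∀ d ∈ F.support, d 0 = 0) (hFq : ∀ d ∈ F.support, q ≤ d.degree) :
    ∀ d ∈ ((X 0 : MvPolynomial (Fin (m + 1)) k) ^ q + F).support,
      1 * q ≤ d.degree ∧ (d 0 = 0 ∨ q ≤ d 0) := by
  classical
  refine forall_support_add (forall_support_X_pow ⟨?_, Or.inr ?_⟩) fun d hd => ⟨?_, Or.inl (hF0 d hd)⟩
  · rw [one_mul, Finsupp.degree_single]
  · rw [Finsupp.single_eq_same]
  · rw [one_mul]; exact hFq d hd

omit [CommRing k] in
/-- Pigeonhole on exponents: a monomial in `x₁, …, x_m` (no `x₀`) with all exponents `≤ p - 1`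
has total degree `≤ m (p - 1)`. [folklore] -/
theorem degree_le_of_forall_lt {p : ℕ} (d : Fin (m + 1) →₀ ℕ) (hd0 : d 0 = 0)
    (hlt : ∀ i, d i < p) : d.degree ≤ m * (p - 1) := by
  rw [Finsupp.degree_eq_sum, Fin.sum_univ_succ, hd0, zero_add]
  calc ∑ i : Fin m, d i.succ ≤ ∑ _i : Fin m, (p - 1) :=
        Finset.sum_le_sum fun i _ => Nat.le_sub_one_of_lt (hlt i.succ)
    _ = m * (p - 1) := by rw [Finset.sum_const, Finset.card_univ, Fintype.card_fin, smul_eq_mul]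

/-- **Box lemma.** For `p ≥ 2`, `p ≤ q`, `m < q` and `F ∈ k[x₀, …, x_m]` not involving `x₀` with
all monomials of total degree `≥ q`, Fedder's element `(x₀^q + F)^{p-1}` lies in the Frobenius
power `(x₀^p, …, x_m^p)` of the maximal ideal; by Fedder's criterion the germ `x₀^q + F` is not
F-pure. [folklore; Fedder1983 Thm. 1.12 for the criterion] -/
theorem fedderElement_mem_span_X_pow {p q : ℕ} (hp : 2 ≤ p) (hpq : p ≤ q) (hmq : m < q)
    (F : MvPolynomial (Fin (m + 1)) k)
    (hF0 : ∀ d ∈ F.support, d 0 = 0) (hFq : ∀ d ∈ F.support, q ≤ d.degree) :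
    ((X 0 : MvPolynomial (Fin (m + 1)) k) ^ q + F) ^ (p - 1) ∈
      Ideal.span (Set.range fun i : Fin (m + 1) => (X i : MvPolynomial (Fin (m + 1)) k) ^ p) := by
  classical
  rw [mem_span_X_pow_iff]
  intro d hd
  have hP : ((p - 1) * 1) * q ≤ d.degree ∧ (d 0 = 0 ∨ q ≤ d 0) :=
    forall_support_pow (P := fun n d => n * q ≤ d.degree ∧ (d 0 = 0 ∨ q ≤ d 0))
      ⟨by rw [zero_mul]; exact Nat.zero_le _, Or.inl rfl⟩
      (boxPred_add q) (boxPred_base q F hF0 hFq) (p - 1) d hd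
  rw [mul_one] at hP
  rcases hP.2 with h0 | h0
  · by_contra hne
    push Not at hne
    have hle := degree_le_of_forall_lt (p := p) d h0 hne
    have h1 : m * (p - 1) < q * (p - 1) :=
      Nat.mul_lt_mul_of_pos_right hmq (Nat.sub_pos_of_lt hp)
    have h2 : (p - 1) * q ≤ d.degree := hP.1
    rw [mul_comm] at h2
    omega
  · exact ⟨0, le_trans hpq h0⟩

/-- The dimension-3 corollary in the kangaroo atlas' shape: `x₀^q + F(x₁, x₂)` with `ord F ≥ q ≥ 3`
and `2 ≤ p ≤ q` — every `q ∈ {3, 4, 5, 9}` surface row of the atlas — has its Fedder element in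
`𝔪^[p]`. [folklore] -/
theorem fedderElement_mem_span_X_pow_dim3 {p q : ℕ} (hp : 2 ≤ p) (hpq : p ≤ q) (hq : 3 ≤ q)
    (F : MvPolynomial (Fin 3) k)
    (hF0 : ∀ d ∈ F.support, d 0 = 0) (hFq : ∀ d ∈ F.support, q ≤ d.degree) :
    ((X 0 : MvPolynomial (Fin 3) k) ^ q + F) ^ (p - 1) ∈
      Ideal.span (Set.range fun i : Fin 3 => (X i : MvPolynomial (Fin 3) k) ^ p) :=
  fedderElement_mem_span_X_pow (m := 2) hp hpq hq F hF0 hFq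

end Summit.ResolutionOfSingularities.ResolutionOfSingularities.Theorems.FRationalResolution.FedderBox
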